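import Mathlib
import HarnessLib
import Summits.AtomisticToContinuum.Crystallization.Theorems.HolmgrenBoyleLindHalfSpaceUniqueContinuationInterfaceSources
import Summits.AtomisticToContinuum.Crystallization.Theorems.HolmgrenBoyleLindHalfSpaceUniqueContinuationRungsOfCores
import Summits.AtomisticToContinuum.Crystallization.Theorems.HolmgrenBoyleLindUCContinuum
import Summits.AtomisticToContinuum.Crystallization.Theorems.HolmgrenBoyleLindCentrosymmetric

/-!
# Route `HolmgrenBoyleLind`: Lennard-Jones force fields of separated sources, part 17c —
INTERFACE RIGIDITY (pair form) and irrational Bravais half-crystals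

Support file for the crux item stmt-AtomisticToContinuum-6075 (`HalfSpaceUniqueContinuation`, line
`registered`, layered core; written by lead c3). The first THIN-COLUMN theorem of the line: the
observers `x₀ + nγ` below an interface with totally irrational stacking registry have pairwise
distinct registries, so no normal column carries two of them and none of the thick-column results
(parts RecurrentColumns / ThickRegistry) applies; instead force balance at the observers is the
moment sequence of a complex measure on a hedgehog (parts 14–17b).

* **`hbl_interface_rigidity'`** (+ registered `∀`-form `hbl_interface_rigidity`) — two
  `δ`-separated sets in exact Lennard-Jones force balance with common horizontal periods `s, t`,
  agreeing below a horizontal plane, one of them invariant below the plane under a translation `γ`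
  pointing down with totally irrational registry, coincide;
* **`hbl_lattice_eq_of_irrational_halfSpace`** — corollary: a separated balanced set, invariant
  under `s, t ∈ L`, equal to the full-rank lattice `L` below a plane whose stacking vector `γ ∈ L`
  has totally irrational registry, IS `L` (complement of `hbl_lattice_eq_of_registered_halfSpace`).
All `[folklore]`; nothing here closes an item.
-/

noncomputable section

namespace Summit.AtomisticToContinuum.Crystallization.Theorems.HolmgrenBoyleLind

open scoped BigOperators Topology InnerProductSpace RealInnerProductSpace FourierTransform
open MeasureTheory Filter Set Literature.Algebra.EuclideanLattices.LatticePeriodic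
  Literature.Analysis.SpecialFunctions
open scoped Classical

/-- **INTERFACE RIGIDITY (pair form; first thin-column theorem of the layered core).** Let
`ω, ω' ⊂ ℝ³` be `δ`-separated and in exact Lennard-Jones force balance, with two common
independent horizontal periods `s, t ⊥ u` (`‖u‖ = 1`), and suppose they agree on the open half-space
`{⟪z, u⟫ < a}`. Assume that below the plane `ω` is invariant under a further translation `γ`
pointing down (`⟪γ, u⟫ < 0`; e.g. `ω` agrees below the plane with a fully periodic crystal
`L + ℤγ`), that some point of `ω` lies below the plane, and that the stacking registry of `γ` is
TOTALLY IRRATIONAL: no non-zero horizontal vector pairing integrally with `s` and `t` pairs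
integrally with `γ`. Then `ω = ω'`. Proof: the observers `x₀ + nγ` form an arithmetic progression
of registries and depths; the mode expansion of the signed difference field on horizontal planes
(part 14) turns force balance at these observers into the hedgehog moments of part 16, whose
conclusion (all height fibres of all modes vanish) empties every defect layer (part 11b).
[folklore] -/
theorem hbl_interface_rigidity' {ω ω' : Set (EuclideanSpace ℝ (Fin 3))} {δ : ℝ} (hδ : 0 < δ)
    (hsep : ∀ x ∈ ω, ∀ y ∈ ω, x ≠ y → δ ≤ dist x y)
    (hsep' : ∀ x ∈ ω', ∀ y ∈ ω', x ≠ y → δ ≤ dist x y)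
    (hbal : ∀ x ∈ ω, HasSum (fun y : {y : EuclideanSpace ℝ (Fin 3) // y ∈ ω ∧ y ≠ x} =>
      (deriv Literature.MathematicalPhysics.StatisticalMechanics.lennardJones (dist x y) / dist x y) •
        (x - (y : EuclideanSpace ℝ (Fin 3)))) 0)
    (hbal' : ∀ x ∈ ω', HasSum (fun y : {y : EuclideanSpace ℝ (Fin 3) // y ∈ ω' ∧ y ≠ x} =>
      (deriv Literature.MathematicalPhysics.StatisticalMechanics.lennardJones (dist x y) / dist x y) •
        (x - (y : EuclideanSpace ℝ (Fin 3)))) 0)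
    {s t u : EuclideanSpace ℝ (Fin 3)} {a : ℝ} (hu : ‖u‖ = 1) (ht0 : t ≠ 0)
    (hst : s ∉ Submodule.span ℝ ({t} : Set (EuclideanSpace ℝ (Fin 3))))
    (hsu : ⟪s, u⟫ = 0) (htu : ⟪t, u⟫ = 0)
    (hωt : ∀ x : EuclideanSpace ℝ (Fin 3), x + t ∈ ω ↔ x ∈ ω)
    (hωs : ∀ x : EuclideanSpace ℝ (Fin 3), x + s ∈ ω ↔ x ∈ ω)
    (hω't : ∀ x : EuclideanSpace ℝ (Fin 3), x + t ∈ ω' ↔ x ∈ ω')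
    (hω's : ∀ x : EuclideanSpace ℝ (Fin 3), x + s ∈ ω' ↔ x ∈ ω')
    (hagree : ∀ z : EuclideanSpace ℝ (Fin 3), ⟪z, u⟫ < a → (z ∈ ω ↔ z ∈ ω'))
    {x₀ γ : EuclideanSpace ℝ (Fin 3)} (hx₀ : x₀ ∈ ω) (hx₀a : ⟪x₀, u⟫ < a) (hγ : ⟪γ, u⟫ < 0)
    (hγinv : ∀ z : EuclideanSpace ℝ (Fin 3), ⟪z, u⟫ < a → z ∈ ω → z + γ ∈ ω)
    (hirr : ∀ w : EuclideanSpace ℝ (Fin 3), ⟪w, u⟫ = 0 → (∃ m : ℤ, ⟪w, s⟫ = m) →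
      (∃ m : ℤ, ⟪w, t⟫ = m) → (∃ m : ℤ, ⟪w, γ⟫ = m) → w = 0) :
    ω = ω' := by
  classical
  -- the plane and its lattice of common periods
  have hu0 : u ≠ 0 := by
    intro h0; rw [h0, norm_zero] at hu; exact zero_ne_one hu
  have hV : Module.finrank ℝ (ℝ ∙ u)ᗮ = 2 := hbl_finrank_orthogonal_span_singleton hu0
  have hsW : s ∈ (ℝ ∙ u)ᗮ := by
    rw [Submodule.mem_orthogonal_singleton_iff_inner_right, real_inner_comm]; exact hsu
  have htW : t ∈ (ℝ ∙ u)ᗮ := by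
    rw [Submodule.mem_orthogonal_singleton_iff_inner_right, real_inner_comm]; exact htu
  set sW : (ℝ ∙ u)ᗮ := ⟨s, hsW⟩ with hsWdef
  set tW : (ℝ ∙ u)ᗮ := ⟨t, htW⟩ with htWdef
  have hli : LinearIndependent ℝ ![tW, sW] := by
    rw [LinearIndependent.pair_iff]
    intro c d hcd
    have hcd' : c • t + d • s = 0 := by
      have := congrArg (fun x : (ℝ ∙ u)ᗮ => (x : EuclideanSpace ℝ (Fin 3))) hcd
      simpa [hsWdef, htWdef] using this
    by_cases hd : d = 0
    · refine ⟨?_, hd⟩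
      rw [hd, zero_smul, add_zero] at hcd'
      exact (smul_eq_zero.1 hcd').resolve_right ht0
    · exfalso
      apply hst
      have hs_eq : s = (-(c / d)) • t := by
        have : d • s = -(c • t) := eq_neg_of_add_eq_zero_right hcd'
        calc s = d⁻¹ • (d • s) := by rw [smul_smul, inv_mul_cancel₀ hd, one_smul]
          _ = (-(c / d)) • t := by rw [this, smul_neg, smul_smul, neg_smul]; ring_nf
      rw [hs_eq]
      exact Submodule.smul_mem _ _ (Submodule.mem_span_singleton_self t)
  set bW : Module.Basis (Fin 2) ℝ (ℝ ∙ u)ᗮ :=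
    basisOfLinearIndependentOfCardEqFinrank hli (by rw [hV]; simp) with hbW
  set Λ : Submodule ℤ (ℝ ∙ u)ᗮ := Submodule.span ℤ (Set.range bW) with hΛ
  have hbW0 : bW 0 = tW := by rw [hbW, coe_basisOfLinearIndependentOfCardEqFinrank]; rfl
  have hbW1 : bW 1 = sW := by rw [hbW, coe_basisOfLinearIndependentOfCardEqFinrank]; rfl
  have htΛ : tW ∈ Λ := hbW0 ▸ Submodule.subset_span ⟨0, rfl⟩
  have hsΛ : sW ∈ Λ := hbW1 ▸ Submodule.subset_span ⟨1, rfl⟩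
  -- invariance of `ω, ω'` under `Λ`
  have hinvgen : ∀ (S : Set (EuclideanSpace ℝ (Fin 3))),
      (∀ x : EuclideanSpace ℝ (Fin 3), x + t ∈ S ↔ x ∈ S) →
      (∀ x : EuclideanSpace ℝ (Fin 3), x + s ∈ S ↔ x ∈ S) →
      ∀ ℓ : Λ, ∀ y : EuclideanSpace ℝ (Fin 3),
        y + ((ℓ : (ℝ ∙ u)ᗮ) : EuclideanSpace ℝ (Fin 3)) ∈ S ↔ y ∈ S := by
    intro S hSt hSs ℓ
    refine hbl_invariant_of_span bW (S := S) (fun i => ?_) ℓ.2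
    fin_cases i
    · simpa [hbW0, htWdef] using hSt
    · simpa [hbW1, hsWdef] using hSs
  have hωΛ := hinvgen ω hωt hωs
  have hω'Λ := hinvgen ω' hω't hω's
  -- the signed source `Dp = ω ∖ ω'`, `Dm = ω' ∖ ω`
  set Dp : Set (EuclideanSpace ℝ (Fin 3)) := {y | y ∈ ω ∧ y ∉ ω'} with hDpdef
  set Dm : Set (EuclideanSpace ℝ (Fin 3)) := {y | y ∈ ω' ∧ y ∉ ω} with hDmdef
  have hdisj : Disjoint Dp Dm := Set.disjoint_left.2 fun y hp hm => hm.2 hp.1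
  have hsepp : ∀ x ∈ Dp, ∀ y ∈ Dp, x ≠ y → δ ≤ dist x y :=
    fun x hx y hy hxy => hsep x hx.1 y hy.1 hxy
  have hsepm : ∀ x ∈ Dm, ∀ y ∈ Dm, x ≠ y → δ ≤ dist x y :=
    fun x hx y hy hxy => hsep' x hx.1 y hy.1 hxy
  have hap : ∀ y ∈ Dp, a ≤ ⟪y, u⟫ := by
    intro y hy
    by_contra hlt
    exact hy.2 ((hagree y (not_le.1 hlt)).1 hy.1)
  have ham : ∀ y ∈ Dm, a ≤ ⟪y, u⟫ := by
    intro y hy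
    by_contra hlt
    exact hy.2 ((hagree y (not_le.1 hlt)).2 hy.1)
  have hDp : ∀ ℓ : Λ, ∀ y : EuclideanSpace ℝ (Fin 3),
      y + ((ℓ : (ℝ ∙ u)ᗮ) : EuclideanSpace ℝ (Fin 3)) ∈ Dp ↔ y ∈ Dp := by
    intro ℓ y
    simp only [hDpdef, Set.mem_setOf_eq]
    rw [hωΛ ℓ y, hω'Λ ℓ y]
  have hDm : ∀ ℓ : Λ, ∀ y : EuclideanSpace ℝ (Fin 3),
      y + ((ℓ : (ℝ ∙ u)ᗮ) : EuclideanSpace ℝ (Fin 3)) ∈ Dm ↔ y ∈ Dm := by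
    intro ℓ y
    simp only [hDmdef, Set.mem_setOf_eq]
    rw [hωΛ ℓ y, hω'Λ ℓ y]
  -- injectivity of the registry step character
  have hinj : Function.Injective fun k : Fin (Module.finrank ℝ (ℝ ∙ u)ᗮ) → ℤ =>
      echar Λ k ((ℝ ∙ u)ᗮ.orthogonalProjectionOnto γ) :=
    hbl_echar_injective_of_irrational Λ ⟨⟨sW, hsΛ⟩, rfl⟩ ⟨⟨tW, htΛ⟩, rfl⟩ hirr
  -- the observers `x₀ + n γ`: in `ω`, below the plane
  have hobsmem : ∀ n : ℕ, x₀ + (n : ℝ) • γ ∈ ω ∧ ⟪x₀ + (n : ℝ) • γ, u⟫ < a := by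
    intro n
    induction n with
    | zero => simpa using ⟨hx₀, hx₀a⟩
    | succ n ih =>
      have heq : x₀ + ((n + 1 : ℕ) : ℝ) • γ = (x₀ + (n : ℝ) • γ) + γ := by
        rw [Nat.cast_succ, add_smul, one_smul, add_assoc]
      rw [heq]
      refine ⟨hγinv _ ih.2 ih.1, ?_⟩
      rw [inner_add_left]
      linarith [ih.2]
  -- force balance at the observers: the vertical component of the signed field vanishes
  have hobs : ∀ n : ℕ,
      (∑' yy : ↥(Dp ∪ Dm), (if (yy : EuclideanSpace ℝ (Fin 3)) ∈ Dp then (1 : ℂ) else -1) *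
        ((⟪u, ((((‖(x₀ + (n : ℝ) • γ) - (yy : EuclideanSpace ℝ (Fin 3))‖ ^ 2) ^ 4)⁻¹ -
            ((‖(x₀ + (n : ℝ) • γ) - (yy : EuclideanSpace ℝ (Fin 3))‖ ^ 2) ^ 7)⁻¹) •
              ((x₀ + (n : ℝ) • γ) - (yy : EuclideanSpace ℝ (Fin 3))))⟫ : ℝ) : ℂ)) = 0 := by
    intro n
    set z := x₀ + (n : ℝ) • γ with hzdef
    obtain ⟨hzω, hza⟩ := hobsmem n
    have hvec := hbl_diffField_eq_zero_on_halfSpace hδ hsep hsep' hbal hbal' hagree z hzω hza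
    -- rewrite the pair forces as kernels
    have hker : ∀ y : EuclideanSpace ℝ (Fin 3), y ∈ Dp ∪ Dm →
        (deriv Literature.MathematicalPhysics.StatisticalMechanics.lennardJones (dist z y) / dist z y) •
          (z - y) = ((((‖z - y‖ ^ 2) ^ 4)⁻¹ - ((‖z - y‖ ^ 2) ^ 7)⁻¹) • (z - y)) := by
      intro y hy
      refine ljForce_eq_kernel fun hyz => ?_
      have hay : a ≤ ⟪y, u⟫ := by
        rcases hy with h | h
        · exact hap y h
        · exact ham y h
      rw [hyz] at hay
      linarith
    have hvec' : (∑' y : Dp, ((((‖z - (y : EuclideanSpace ℝ (Fin 3))‖ ^ 2) ^ 4)⁻¹ -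
          ((‖z - (y : EuclideanSpace ℝ (Fin 3))‖ ^ 2) ^ 7)⁻¹) • (z - (y : EuclideanSpace ℝ (Fin 3))))) -
        (∑' y : Dm, ((((‖z - (y : EuclideanSpace ℝ (Fin 3))‖ ^ 2) ^ 4)⁻¹ -
          ((‖z - (y : EuclideanSpace ℝ (Fin 3))‖ ^ 2) ^ 7)⁻¹) • (z - (y : EuclideanSpace ℝ (Fin 3))))) = 0 := by
      rw [← hvec]
      congr 1
      · exact tsum_congr fun y => (hker y (Or.inl y.2)).symm
      · exact tsum_congr fun y => (hker y (Or.inr y.2)).symm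
    have hX : 0 < a - ⟪z, u⟫ := by linarith
    have hz : z = (((ℝ ∙ u)ᗮ.orthogonalProjectionOnto z : (ℝ ∙ u)ᗮ) : EuclideanSpace ℝ (Fin 3)) +
        (a - (a - ⟪z, u⟫)) • u := by
      rw [sub_sub_cancel]
      exact hbl_eq_proj_add_inner_smul hu z
    have hid := hbl_inner_signedField_eq_tsum hu hδ hdisj hsepp hsepm hap ham u
      ((ℝ ∙ u)ᗮ.orthogonalProjectionOnto z) hX z hz
    rw [hvec', inner_zero_right, Complex.ofReal_zero] at hid
    convert hid.symm using 4
    split_ifs <;> rfl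
  obtain ⟨hDp0, hDm0⟩ := hbl_signedSource_empty_of_arith_observers' hu Λ hδ hdisj hsepp hsepm hap
    ham hDp hDm x₀ γ hx₀a hγ hinj (fun n => by convert hobs n using 4; split_ifs <;> rfl)
  ext y
  constructor
  · intro hy
    by_contra hy'
    have : y ∈ Dp := ⟨hy, hy'⟩
    rw [hDp0] at this
    exact this
  · intro hy'
    by_contra hy
    have : y ∈ Dm := ⟨hy', hy⟩
    rw [hDm0] at this
    exact this

/-- **Irrational Bravais half-crystals are rigid.** Let `L ⊂ ℝ³` be a full-rank lattice and
`s, t, γ ∈ L` with `s, t ⊥ u` independent (`‖u‖ = 1`) and `⟪γ, u⟫ < 0`, such that the stacking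
registry of `γ` over the layer lattice `ℤs + ℤt` is totally irrational (no non-zero horizontal
vector pairing integrally with `s, t` pairs integrally with `γ`). Then a `δ`-separated set in exact
Lennard-Jones force balance, invariant under `s` and `t`, that coincides with `L` on the open
half-space `{⟪z, u⟫ < a}` IS `L`: no defect, relaxation-free interface or foreign overlayer on an
irrational facet of a Bravais crystal is an exact equilibrium. (Complement of the registered /
rational case `hbl_lattice_eq_of_registered_halfSpace`; `hbl_interface_rigidity'` with `ω' = L`,
which is separated and balanced by `hbl_lattice_hypotheses`.) [folklore] -/
theorem hbl_lattice_eq_of_irrational_halfSpace (L : Submodule ℤ (EuclideanSpace ℝ (Fin 3)))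
    [DiscreteTopology L] [IsZLattice ℝ L] {s t γ u : EuclideanSpace ℝ (Fin 3)} {a : ℝ}
    (hsL : s ∈ L) (htL : t ∈ L) (hγL : γ ∈ L) (hu : ‖u‖ = 1) (ht0 : t ≠ 0)
    (hst : s ∉ Submodule.span ℝ ({t} : Set (EuclideanSpace ℝ (Fin 3))))
    (hsu : ⟪s, u⟫ = 0) (htu : ⟪t, u⟫ = 0) (hγ : ⟪γ, u⟫ < 0)
    (hirr : ∀ w : EuclideanSpace ℝ (Fin 3), ⟪w, u⟫ = 0 → (∃ m : ℤ, ⟪w, s⟫ = m) →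
      (∃ m : ℤ, ⟪w, t⟫ = m) → (∃ m : ℤ, ⟪w, γ⟫ = m) → w = 0)
    {ω : Set (EuclideanSpace ℝ (Fin 3))} {δ : ℝ} (hδ : 0 < δ)
    (hsep : ∀ x ∈ ω, ∀ y ∈ ω, x ≠ y → δ ≤ dist x y)
    (hbal : ∀ x ∈ ω, HasSum (fun y : {y : EuclideanSpace ℝ (Fin 3) // y ∈ ω ∧ y ≠ x} =>
      (deriv Literature.MathematicalPhysics.StatisticalMechanics.lennardJones (dist x y) / dist x y) •
        (x - (y : EuclideanSpace ℝ (Fin 3)))) 0)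
    (hωt : ∀ x : EuclideanSpace ℝ (Fin 3), x + t ∈ ω ↔ x ∈ ω)
    (hωs : ∀ x : EuclideanSpace ℝ (Fin 3), x + s ∈ ω ↔ x ∈ ω)
    (hagree : ∀ z : EuclideanSpace ℝ (Fin 3), ⟪z, u⟫ < a →
      (z ∈ ω ↔ z ∈ (L : Set (EuclideanSpace ℝ (Fin 3))))) :
    ω = (L : Set (EuclideanSpace ℝ (Fin 3))) := by
  obtain ⟨δL, -, hδL, -, hsepL, -, -, hbalL⟩ := hbl_lattice_hypotheses L
  -- a common separation constant
  have hsep1 : ∀ x ∈ ω, ∀ y ∈ ω, x ≠ y → min δ δL ≤ dist x y :=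
    fun x hx y hy hxy => (min_le_left _ _).trans (hsep x hx y hy hxy)
  have hsep2 : ∀ x ∈ (L : Set (EuclideanSpace ℝ (Fin 3))), ∀ y ∈ (L : Set (EuclideanSpace ℝ (Fin 3))),
      x ≠ y → min δ δL ≤ dist x y :=
    fun x hx y hy hxy => (min_le_right _ _).trans (hsepL x hx y hy hxy)
  -- periods of `L`
  have hLt : ∀ x : EuclideanSpace ℝ (Fin 3), x + t ∈ (L : Set (EuclideanSpace ℝ (Fin 3))) ↔
      x ∈ (L : Set (EuclideanSpace ℝ (Fin 3))) := fun x =>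
    ⟨fun h => by simpa using L.sub_mem h htL, fun h => L.add_mem h htL⟩
  have hLs : ∀ x : EuclideanSpace ℝ (Fin 3), x + s ∈ (L : Set (EuclideanSpace ℝ (Fin 3))) ↔
      x ∈ (L : Set (EuclideanSpace ℝ (Fin 3))) := fun x =>
    ⟨fun h => by simpa using L.sub_mem h hsL, fun h => L.add_mem h hsL⟩
  -- an observer: `n₀ γ` lies below the plane for `n₀` large
  obtain ⟨n₀, hn₀⟩ := exists_nat_gt ((|a| + 1) / (-⟪γ, u⟫))
  have hγpos : 0 < -⟪γ, u⟫ := by linarith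
  have hx₀a : ⟪(n₀ : ℝ) • γ, u⟫ < a := by
    rw [real_inner_smul_left]
    have h1 : (|a| + 1) < (n₀ : ℝ) * (-⟪γ, u⟫) := by
      rwa [div_lt_iff₀ hγpos] at hn₀
    linarith [neg_abs_le a]
  have hx₀L : (n₀ : ℝ) • γ ∈ (L : Set (EuclideanSpace ℝ (Fin 3))) := by
    rw [Nat.cast_smul_eq_nsmul]
    exact L.toAddSubgroup.nsmul_mem hγL n₀
  have hx₀ : (n₀ : ℝ) • γ ∈ ω := (hagree _ hx₀a).2 hx₀L
  have hγinv : ∀ z : EuclideanSpace ℝ (Fin 3), ⟪z, u⟫ < a → z ∈ ω → z + γ ∈ ω := by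
    intro z hz hzω
    have hzL : z ∈ (L : Set (EuclideanSpace ℝ (Fin 3))) := (hagree z hz).1 hzω
    have hz' : ⟪z + γ, u⟫ < a := by rw [inner_add_left]; linarith
    exact (hagree _ hz').2 (L.add_mem hzL hγL)
  exact hbl_interface_rigidity' (lt_min hδ hδL) hsep1 hsep2 hbal hbalL hu ht0 hst hsu htu hωt hωs
    hLt hLs hagree hx₀ hx₀a hγ hγinv hirr

/-- **INTERFACE RIGIDITY** (registered `∀`-form of `hbl_interface_rigidity'`). [folklore] -/
theorem hbl_interface_rigidity : ∀ (ω ω' : Set (EuclideanSpace ℝ (Fin 3))) (δ : ℝ), 0 < δ → (∀ x ∈ ω, ∀ y ∈ ω, x ≠ y → δ ≤ dist x y) → (∀ x ∈ ω', ∀ y ∈ ω', x ≠ y → δ ≤ dist x y) → (∀ x ∈ ω, HasSum (fun y : {y : EuclideanSpace ℝ (Fin 3) // y ∈ ω ∧ y ≠ x} => (deriv Literature.MathematicalPhysics.StatisticalMechanics.lennardJones (dist x y) / dist x y) • (x - (y : EuclideanSpace ℝ (Fin 3)))) 0) → (∀ x ∈ ω', HasSum (fun y : {y : EuclideanSpace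 ℝ (Fin 3) // y ∈ ω' ∧ y ≠ x} => (deriv Literature.MathematicalPhysics.StatisticalMechanics.lennardJones (dist x y) / dist x y) • (x - (y : EuclideanSpace ℝ (Fin 3)))) 0) → ∀ (s t u : EuclideanSpace ℝ (Fin 3)) (a : ℝ), ‖u‖ = 1 → t ≠ 0 → s ∉ Submodule.span ℝ ({t} : Set (EuclideanSpace ℝ (Fin 3))) → inner ℝ s u = 0 → inner ℝ t u = 0 → (∀ x : EuclideanSpace ℝ (Fin 3), x + t ∈ ω ↔ x ∈ ω) → (∀ x : EuclideanSpace ℝ (Fin 3), x + s ∈ ω ↔ x ∈ ω) → (∀ x : EuclideanSpace ℝ (Fin 3), x + t ∈ ω' ↔ x ∈ ω') → (∀ x : EuclideanSpace ℝ (Fin 3), x + s ∈ ω' ↔ x ∈ ω') → (∀ z : EuclideanSpace ℝ (Fin 3), inner ℝ z u < a → (z ∈ ω ↔ z ∈ ω')) → ∀ (x₀ γ : EuclideanSpace ℝ (Fin 3)), x₀ ∈ ω → inner ℝ x₀ u < a → inner ℝ γ u < 0 → (∀ z : EuclideanSpace ℝ (Fin 3), inner ℝ z u < a → z ∈ ω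 → z + γ ∈ ω) → (∀ w : EuclideanSpace ℝ (Fin 3), inner ℝ w u = 0 → (∃ m : ℤ, inner ℝ w s = m) → (∃ m : ℤ, inner ℝ w t = m) → (∃ m : ℤ, inner ℝ w γ = m) → w = 0) → ω = ω' := by
  intro ω ω' δ hδ hsep hsep' hbal hbal' s t u a hu ht0 hst hsu htu hωt hωs hω't hω's hagree x₀ γ hx₀
    hx₀a hγ hγinv hirr
  exact hbl_interface_rigidity' hδ hsep hsep' hbal hbal' hu ht0 hst hsu htu hωt hωs hω't hω's hagree
    hx₀ hx₀a hγ hγinv hirr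

end Summit.AtomisticToContinuum.Crystallization.Theorems.HolmgrenBoyleLind

end
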